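import Summits.QuantumFields.YangMills.Theorems.InfiniteVolumeContinuumOnsetFloorsKOfUniformFloors
import HarnessLib

/-!
# Leaf `InfiniteVolumeContinuum.HypercubicOSDataFromInfiniteVolume` (stmt-QuantumFields-19868), stub N, part 5 — and
# NT line «n32-variance» (stmt-QuantumFields-19353), stub `stub_n32T : N32T`: THE WEAKEST TWO-POINT INPUT THE GLUE USES
# is an AXIAL-BALL floor (pairs whose physical separation vector lies in ONE ball on the time axis), not the isotropic
# window floor of `N32T`

Helper file (`--supports stmt-QuantumFields-19868`) of prover seat `ymfull-r2a-prover-1` (R590-ym item 13: stub N of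
`octave_doubling`, then the N32 stubs of R590 (12)'s line `Cruxes/NT/Lines/n32_variance.lean`).

OBSERVATION (weakest used consequence of `stub_n32T`).  Clause (i) of `LowerBounds(K)` tests the reflection pair
`(θv, v)` of ONE bump `v` centred at `p = (T/2)·e₀`; the pairs `(x, y)` it charges have `a·x` within `2ρ` of `θp = −p` and
`a·y` within `2ρ` of `p`, so the physical separation vector `a·(y − x)` lies in the ball `B̄(T·e₀, 4ρ)` ON THE TIME AXIS.
Hence the glue `clauseI_of_uniformTwoPointFloor` of the line (and part 4's K-twin) consumes the isotropic window floor
`UniformTwoPointFloor` (EVERY pair with `a‖y−x‖ ∈ [s₀, s₁]`, every direction) only through: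

  **`AxialBallFloor`** (unbundled below): `∃ ν > 0`, `0 < R < T`, `β₅`, `Λ₅`: for `β ≥ β₅`, on every torus with
  `Λ₅ ≤ a(β)·L`, every pair `x, y ∈ box L` with `dist (a(β)·(y − x)) (T·e₀) ≤ R` has `ν·a(β)⁸ ≤ Cov_T(A_x, A_y)`.

This is STRICTLY WEAKER as a statement shape (one ball of separations around a time-like vector instead of a spherical
shell of all directions; the line's own «cheapest falsifier» — a sign change of `n⁸ Cov_T` in SOME lattice direction inside
the window — kills `N32T` but not `AxialBallFloor`), and it is the reflection-positive kinematics of Bałaban's N32′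
(`T4SeparatedLoopFloor.SeparatedLoopFloorTime`: ONE loop and its time-reflected translate).

* `floorK_fst_of_axialBallFloor` — `AxialBallFloor` (unbundled) ⇒ clause (i) of `LowerBoundsK G r a` (bump at `(T/2)e₀`,
  support radius `R/2`; tree `PointwiseFloor.q2Floor_of_pointwise_floor`);
* `axialBallFloor_of_windowFloor` — the window floor (body of `UniformTwoPointFloor`) ⇒ `AxialBallFloor` with
  `T = (s₀+s₁)/2`, `R = (s₁−s₀)/4` (the ball sits inside the shell): so part 4's `lowerBoundsK_of_uniformFloors` and
  the line's `lowerBounds_of_floors` factor through the axial form;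
* `lowerBoundsK_of_axialFloors`, `onsetFloorsK_of_axialFloors` — `AxialBallFloor ∧` (three-point cloud floor) ⇒
  `LowerBoundsK G r a`, and for the SU(2) class ⇒ the leaf's stub N `OnsetFloorsK`;
* `nt_of_axialFloors` — the same two unbundled floors (∀ compact simple `G`, ∃ `(r, a)`) ⇒ `BalabanLadder.NT` BY NAME
  (via `lowerBounds_of_K`): a candidate RE-TYPING of `stub_n32T` for the planner of record (weaker stub, same composition).

HONEST LABEL: CONDITIONAL reductions; the axial floor is as OPEN as N32 ([Balaban1989LargeFieldII] p. 356, announced, not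
printed) — nothing here proves a floor, `NT`, the leaf, any rung or summit; finite-volume / conditional content only; the
Yang–Mills mass gap is NOT proved.
-/

set_option autoImplicit false

noncomputable section

open scoped SchwartzMap
open MeasureTheory Filter Topology Metric
open Literature.MathematicalPhysics.QuantumFieldTheory Literature.MathematicalPhysics.QuantumLattice
open Literature.Probability.LatticeModels
open Summit.QuantumFields.YangMills.Cruxes.OSLegsFromFemtoAndGap.DlrCollarTransfer
open Summit.QuantumFields.YangMills.Theorems.OSLegsFromFemtoAndGap.StubLower
  (exists_bump_schwartz abs_apply_le_norm timeReflection_single_zero norm_single_zero siteToE_sub)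
open Summit.QuantumFields.YangMills.Cruxes.NT
open Summit.QuantumFields.YangMills.Cruxes.AtomicCalibrationR.MirrorCalibration
  (LowerBoundsK OnsetFloorsK lowerBounds_of_K)

namespace Summit.QuantumFields.YangMills.Cruxes.HypercubicOSDataFromInfiniteVolume.OnsetFloorsN

section Axial

variable (G : Type) [Group G] [TopologicalSpace G] [IsTopologicalGroup G] [CompactSpace G]
  [MeasurableSpace G] [BorelSpace G] (r : LatticeRep G)

/-- **Clause (i) of `LowerBoundsK` from an AXIAL-BALL floor.**  If `0 < R < T` and, for `β ≥ β₅`, on every torus with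
`Λ₅ ≤ a(β)·L`, every pair of sites whose physical separation vector lies in the ball `B̄(T·e₀, R)` has
`ν·a(β)⁸ ≤ Cov_T(A_x, A_y)` (`ν > 0`), then a non-negative bump `v` centred at `(T/2)·e₀` with support radius `R/2`
(compact, in positive time since `R < T`) carries `ε ≤ Q2_{β,L,aβ}(θv, v)` on every large torus: its reflected cloud
charges only pairs with separation in that ball. [folklore] -/
theorem floorK_fst_of_axialBallFloor (a : ℝ → ℝ) (ha : ∀ β, 0 < a β) (ha0 : Tendsto a atTop (𝓝 0))
    {ν T R β₅ Λ₅ : ℝ} (hν : 0 < ν) (hR : 0 < R) (hRT : R < T)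
    (hfl : ∀ β : ℝ, β₅ ≤ β → ∀ L : ℕ, Λ₅ ≤ a β * L → ∀ x ∈ box 4 L, ∀ y ∈ box 4 L,
      dist (a β • siteToE (y - x)) (EuclideanSpace.single 0 T) ≤ R →
        ν * a β ^ 8 ≤ torusE G r β L (fun U => dens G r x U * dens G r y U) -
          torusE G r β L (dens G r x) * torusE G r β L (dens G r y)) :
    ∃ (v : 𝓢(EuclideanSpace ℝ (Fin 4), ℝ)) (ε β₆ Λ₆ : ℝ),
      HasCompactSupport (v : EuclideanSpace ℝ (Fin 4) → ℝ) ∧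
      tsupport (v : EuclideanSpace ℝ (Fin 4) → ℝ) ⊆ {y : EuclideanSpace ℝ (Fin 4) | 0 < y 0} ∧ 0 < ε ∧
      ∀ β : ℝ, β₆ ≤ β → ∀ L : ℕ, Λ₆ ≤ a β * L → ε ≤ Q2 G r β L (a β) (thetaTest 4 v) v := by
  have hT : 0 < T := hR.trans hRT
  -- the bump: centre `p = (T/2) e₀`, plateau radius `R/4`, support radius `R/2`
  set p : EuclideanSpace ℝ (Fin 4) := EuclideanSpace.single 0 (T / 2) with hp
  have hρ0 : 0 < R / 4 := by positivity
  obtain ⟨v, hv0, -, hvone, hvsupp, hvts⟩ := exists_bump_schwartz p hρ0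
  have e2ρ : 2 * (R / 4) = R / 2 := by ring
  rw [e2ρ] at hvsupp hvts
  have hpp : p + p = EuclideanSpace.single 0 T := by
    ext j
    simp only [hp, PiLp.add_apply, PiLp.single_apply]
    split_ifs <;> ring
  have hnp : ‖p‖ = T / 2 := by rw [hp, norm_single_zero, abs_of_pos (by positivity)]
  -- compact support
  have hK : HasCompactSupport (v : EuclideanSpace ℝ (Fin 4) → ℝ) := by
    show IsCompact (tsupport (v : EuclideanSpace ℝ (Fin 4) → ℝ))
    rw [hvts]; exact isCompact_closedBall _ _
  -- positive time: the closed ball of radius `R/2 < T/2` around `(T/2) e₀`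
  have hpos : tsupport (v : EuclideanSpace ℝ (Fin 4) → ℝ) ⊆ {y : EuclideanSpace ℝ (Fin 4) | 0 < y 0} := by
    rw [hvts]
    intro y hy
    rw [mem_closedBall, dist_eq_norm] at hy
    have h1 := abs_apply_le_norm (y - p) 0
    have h2 : |y 0 - T / 2| ≤ R / 2 := by simpa [hp] using h1.trans hy
    have h3 := (abs_le.1 h2).1
    show 0 < y 0
    linarith
  -- a ball around the origin containing the support
  have hvσ : tsupport (v : EuclideanSpace ℝ (Fin 4) → ℝ) ⊆ closedBall 0 (R / 2 + T / 2) := by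
    rw [hvts]
    refine closedBall_subset_closedBall' ?_
    rw [dist_zero_right, hnp]
  -- positive mass
  have hv1 : 0 < ∫ y, |v y| := by
    have e : (fun y => |v y|) = fun y => v y := funext fun y => abs_of_nonneg (hv0 y)
    rw [e]
    exact v.continuous.integral_pos_of_hasCompactSupport_nonneg_nonzero hK (fun z => hv0 z)
      (x := p) (by rw [hvone _ (by rw [dist_self]; exact hρ0.le)]; norm_num)
  -- the cloud floor: charged pairs have separation vector in the axial ball
  have hcloud : ∀ β : ℝ, β₅ ≤ β → ∀ L : ℕ, Λ₅ ≤ a β * L → ∀ x ∈ box 4 L, ∀ y ∈ box 4 L,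
      thetaTest 4 v (a β • siteToE x) ≠ 0 → v (a β • siteToE y) ≠ 0 →
        ν * a β ^ 8 ≤ torusE G r β L (fun U => dens G r x U * dens G r y U) -
          torusE G r β L (dens G r x) * torusE G r β L (dens G r y) := by
    intro β hβ L hL x hx y hy hθx hvy
    rw [thetaTest_apply] at hθx
    have hu := hvsupp _ hθx
    have hw := hvsupp _ hvy
    set u : EuclideanSpace ℝ (Fin 4) := a β • siteToE x with hu'
    set w : EuclideanSpace ℝ (Fin 4) := a β • siteToE y with hw'
    have hu2 : ‖u + p‖ < R / 2 := by
      rw [dist_eq_norm] at hu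
      have h : timeReflection 4 u - p = timeReflection 4 (u + p) := by
        rw [map_add, hp, timeReflection_single_zero]; abel
      rwa [h, LinearIsometryEquiv.norm_map] at hu
    have hw2 : ‖w - p‖ < R / 2 := by rwa [dist_eq_norm] at hw
    refine hfl β hβ L hL x hx y hy ?_
    have e : a β • siteToE (y - x) - EuclideanSpace.single 0 T = (w - p) - (u + p) := by
      rw [← hpp, siteToE_sub, smul_sub, ← hw', ← hu']; abel
    rw [dist_eq_norm, e]
    have := norm_sub_le (w - p) (u + p)
    linarith
  obtain ⟨ε, β₆, Λ₆, hε, hfloor⟩ :=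
    PointwiseFloor.q2Floor_of_pointwise_floor G r a ha ha0 hv0 hv1 hvσ hν hcloud
  exact ⟨v, ε, β₆, Λ₆, hK, hpos, hε, hfloor⟩

/-- **The isotropic window floor contains the axial-ball floor**: if `ν a⁸ ≤ Cov_T(A_x, A_y)` for every pair with
`a‖y − x‖ ∈ [s₀, s₁]` (`0 < s₀ < s₁`; the body of the line's `UniformTwoPointFloor`), then in particular for every pair
whose separation vector lies in `B̄(T·e₀, R)` with `T = (s₀+s₁)/2`, `R = (s₁−s₀)/4` — that ball sits inside the shell.
[folklore] -/
theorem axialBallFloor_of_windowFloor (a : ℝ → ℝ) {ν s₀ s₁ β₅ Λ₅ : ℝ} (hs₀ : 0 < s₀) (hs₀₁ : s₀ < s₁)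
    (hfl : ∀ β : ℝ, β₅ ≤ β → ∀ L : ℕ, Λ₅ ≤ a β * L → ∀ x ∈ box 4 L, ∀ y ∈ box 4 L,
      s₀ ≤ a β * ‖siteToE (y - x)‖ → a β * ‖siteToE (y - x)‖ ≤ s₁ →
        ν * a β ^ 8 ≤ torusE G r β L (fun U => dens G r x U * dens G r y U) -
          torusE G r β L (dens G r x) * torusE G r β L (dens G r y))
    (ha : ∀ β, 0 < a β) :
    ∀ β : ℝ, β₅ ≤ β → ∀ L : ℕ, Λ₅ ≤ a β * L → ∀ x ∈ box 4 L, ∀ y ∈ box 4 L,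
      dist (a β • siteToE (y - x)) (EuclideanSpace.single 0 ((s₀ + s₁) / 2)) ≤ (s₁ - s₀) / 4 →
        ν * a β ^ 8 ≤ torusE G r β L (fun U => dens G r x U * dens G r y U) -
          torusE G r β L (dens G r x) * torusE G r β L (dens G r y) := by
  intro β hβ L hL x hx y hy hd
  set q : EuclideanSpace ℝ (Fin 4) := a β • siteToE (y - x) with hq
  set c : EuclideanSpace ℝ (Fin 4) := EuclideanSpace.single 0 ((s₀ + s₁) / 2) with hc
  have hnq : ‖q‖ = a β * ‖siteToE (y - x)‖ := by rw [hq, norm_smul, Real.norm_of_nonneg (ha β).le]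
  rw [dist_eq_norm] at hd
  have h1 : ‖c‖ ≤ ‖q‖ + ‖q - c‖ := by
    have := norm_sub_le q (q - c); simp only [sub_sub_cancel] at this; exact this
  have h2 : ‖q‖ ≤ ‖q - c‖ + ‖c‖ := by
    have := norm_add_le (q - c) c; simp only [sub_add_cancel] at this; exact this
  have hnc : ‖c‖ = (s₀ + s₁) / 2 := by rw [hc, norm_single_zero, abs_of_pos (by linarith)]
  rw [hnc] at h1 h2
  refine hfl β hβ L hL x hx y hy ?_ ?_
  · rw [← hnq]; linarith
  · rw [← hnq]; linarith

/-- **`LowerBoundsK` from the axial-ball two-point floor and the three-point cloud floor** (both unbundled, same units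
`a > 0`, `a → 0`). [folklore] -/
theorem lowerBoundsK_of_axialFloors (a : ℝ → ℝ) (ha : ∀ β, 0 < a β) (ha0 : Tendsto a atTop (𝓝 0))
    (h2 : ∃ ν T R β₅ Λ₅ : ℝ, 0 < ν ∧ 0 < R ∧ R < T ∧
      ∀ β : ℝ, β₅ ≤ β → ∀ L : ℕ, Λ₅ ≤ a β * L → ∀ x ∈ box 4 L, ∀ y ∈ box 4 L,
        dist (a β • siteToE (y - x)) (EuclideanSpace.single 0 T) ≤ R →
          ν * a β ^ 8 ≤ torusE G r β L (fun U => dens G r x U * dens G r y U) -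
            torusE G r β L (dens G r x) * torusE G r β L (dens G r y))
    (h3 : ∃ (p₁ p₂ p₃ : EuclideanSpace ℝ (Fin 4)) (ρ ν₃ sgn β₅ Λ₅ : ℝ), 0 < ρ ∧
      2 * ρ < dist p₁ p₂ ∧ 2 * ρ < dist p₂ p₃ ∧ 2 * ρ < dist p₁ p₃ ∧ 0 < ν₃ ∧ (sgn = 1 ∨ sgn = -1) ∧
      ∀ β : ℝ, β₅ ≤ β → ∀ L : ℕ, Λ₅ ≤ a β * L → ∀ x ∈ box 4 L, ∀ y ∈ box 4 L, ∀ z ∈ box 4 L,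
        a β • siteToE x ∈ closedBall p₁ ρ → a β • siteToE y ∈ closedBall p₂ ρ → a β • siteToE z ∈ closedBall p₃ ρ →
          ν₃ * a β ^ 12 ≤ sgn * torusK3 G r β L x y z) :
    LowerBoundsK G r a := by
  obtain ⟨ν, T, R, β₅, Λ₅, hν, hR, hRT, hfl⟩ := h2
  obtain ⟨p₁, p₂, p₃, ρ, ν₃, sgn, β₅', Λ₅', hρ, h12, h23, h13, hν₃, hsgn, hfl'⟩ := h3
  exact ⟨floorK_fst_of_axialBallFloor G r a ha ha0 hν hR hRT hfl,
    floorK_snd_of_signedCloudFloor G r a ha ha0 hρ h12 h23 h13 hν₃ hsgn hfl'⟩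

end Axial

/-- **N from the axial floors** — if every SU(2)-class `G` carries one `(r, a)` (`0 < a`, `a → 0`) with the axial-ball
two-point floor and the signed three-point cloud floor, then the leaf's registered stub N `OnsetFloorsK` holds.
[folklore] -/
theorem onsetFloorsK_of_axialFloors
    (h : ∀ (G : Type) [Group G] [TopologicalSpace G] [IsTopologicalGroup G] [CompactSpace G],
      IsCompactSimpleLieGroup G → Nonempty (G ≃ₜ* Matrix.specialUnitaryGroup (Fin 2) ℂ) →
      letI : MeasurableSpace G := borel G; haveI : BorelSpace G := ⟨rfl⟩;
      ∃ (r : LatticeRep G) (a : ℝ → ℝ), (∀ β, 0 < a β) ∧ Tendsto a atTop (𝓝 0) ∧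
        (∃ ν T R β₅ Λ₅ : ℝ, 0 < ν ∧ 0 < R ∧ R < T ∧
          ∀ β : ℝ, β₅ ≤ β → ∀ L : ℕ, Λ₅ ≤ a β * L → ∀ x ∈ box 4 L, ∀ y ∈ box 4 L,
            dist (a β • siteToE (y - x)) (EuclideanSpace.single 0 T) ≤ R →
              ν * a β ^ 8 ≤ torusE G r β L (fun U => dens G r x U * dens G r y U) -
                torusE G r β L (dens G r x) * torusE G r β L (dens G r y)) ∧
        (∃ (p₁ p₂ p₃ : EuclideanSpace ℝ (Fin 4)) (ρ ν₃ sgn β₅ Λ₅ : ℝ), 0 < ρ ∧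
          2 * ρ < dist p₁ p₂ ∧ 2 * ρ < dist p₂ p₃ ∧ 2 * ρ < dist p₁ p₃ ∧ 0 < ν₃ ∧ (sgn = 1 ∨ sgn = -1) ∧
          ∀ β : ℝ, β₅ ≤ β → ∀ L : ℕ, Λ₅ ≤ a β * L → ∀ x ∈ box 4 L, ∀ y ∈ box 4 L, ∀ z ∈ box 4 L,
            a β • siteToE x ∈ closedBall p₁ ρ → a β • siteToE y ∈ closedBall p₂ ρ →
              a β • siteToE z ∈ closedBall p₃ ρ → ν₃ * a β ^ 12 ≤ sgn * torusK3 G r β L x y z)) :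
    OnsetFloorsK := by
  refine onsetFloorsK_of_lowerBoundsK fun G _ _ _ _ hG hcl => ?_
  letI : MeasurableSpace G := borel G
  haveI : BorelSpace G := ⟨rfl⟩
  obtain ⟨r, a, ha, ha0, h2, h3⟩ := h G hG hcl
  exact ⟨r, a, ha, ha0, lowerBoundsK_of_axialFloors G r a ha ha0 h2 h3⟩

/-- **The spine's `BalabanLadder.NT` BY NAME from the axial floors** — for every compact simple `G` one `(r, a)`
(`0 < a`, `a → 0`) with the axial-ball two-point floor and the signed three-point cloud floor ⇒ `NT` (through
`LowerBoundsK` and `lowerBounds_of_K`).  A candidate re-typing of `stub_n32T` of the line «n32-variance» by its weakest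
used consequence: the composition `NT_of` survives with the axial floor in place of the isotropic window floor.
[folklore] -/
theorem nt_of_axialFloors
    (h : ∀ (G : Type) [Group G] [TopologicalSpace G] [IsTopologicalGroup G] [CompactSpace G],
      IsCompactSimpleLieGroup G → letI : MeasurableSpace G := borel G; haveI : BorelSpace G := ⟨rfl⟩;
      ∃ (r : LatticeRep G) (a : ℝ → ℝ), (∀ β, 0 < a β) ∧ Tendsto a atTop (𝓝 0) ∧
        (∃ ν T R β₅ Λ₅ : ℝ, 0 < ν ∧ 0 < R ∧ R < T ∧
          ∀ β : ℝ, β₅ ≤ β → ∀ L : ℕ, Λ₅ ≤ a β * L → ∀ x ∈ box 4 L, ∀ y ∈ box 4 L,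
            dist (a β • siteToE (y - x)) (EuclideanSpace.single 0 T) ≤ R →
              ν * a β ^ 8 ≤ torusE G r β L (fun U => dens G r x U * dens G r y U) -
                torusE G r β L (dens G r x) * torusE G r β L (dens G r y)) ∧
        (∃ (p₁ p₂ p₃ : EuclideanSpace ℝ (Fin 4)) (ρ ν₃ sgn β₅ Λ₅ : ℝ), 0 < ρ ∧
          2 * ρ < dist p₁ p₂ ∧ 2 * ρ < dist p₂ p₃ ∧ 2 * ρ < dist p₁ p₃ ∧ 0 < ν₃ ∧ (sgn = 1 ∨ sgn = -1) ∧
          ∀ β : ℝ, β₅ ≤ β → ∀ L : ℕ, Λ₅ ≤ a β * L → ∀ x ∈ box 4 L, ∀ y ∈ box 4 L, ∀ z ∈ box 4 L,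
            a β • siteToE x ∈ closedBall p₁ ρ → a β • siteToE y ∈ closedBall p₂ ρ →
              a β • siteToE z ∈ closedBall p₃ ρ → ν₃ * a β ^ 12 ≤ sgn * torusK3 G r β L x y z)) :
    Summit.QuantumFields.YangMills.Theses.BalabanLadder.NT := by
  intro G _ _ _ _ hG
  letI : MeasurableSpace G := borel G
  haveI : BorelSpace G := ⟨rfl⟩
  obtain ⟨r, a, ha, ha0, h2, h3⟩ := h G hG
  exact ⟨r, a, ha, ha0, lowerBounds_of_K (lowerBoundsK_of_axialFloors G r a ha ha0 h2 h3)⟩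

end Summit.QuantumFields.YangMills.Cruxes.HypercubicOSDataFromInfiniteVolume.OnsetFloorsN

end
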